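import Summits.QuantumFields.YangMills.Theorems.SwapVirialDeficitRingTraceSmooth
import HarnessLib

/-!
# Route `SwapVirialDeficit` (YangMills): the zero-flux ring trace is a MIXTURE of seam sectors — log-derivative in the coupling

Stub `stub_logDerivMixture : LogDerivMixture` of the BC3 skeleton LINE «sector-mixture» for the crux
`SwapVirialDeficit.ToronSoftnessSharp` (item stmt-QuantumFields-24196; planner ym-idea-4 g14, HOME
bc/g14-B/mix/ToronSoftnessSharp_mixture_birth.lean, critic PASS).  With `Z(b) = TT.physTrace L b (2L) = (1/8) Σ_z W_z(b)`
(✓`TT.physTraceSucc_eq_sum_sectorWeight`) and the sector probabilities `p_z := W_z(β) / (8 Z(β))` one has `p_z ≥ 0`, `Σ_z p_z = 1`,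
`W_z(β) = p_z · 8Z(β)` and `(log Z)′(β) = Σ_z p_z · (log W_z)′(β)` (derivative of the log of a positive sum of differentiable positive
functions, ✓`differentiable_sectorWeight_one` / ✓`sectorWeight_one_pos`).  The statement below (`logDerivMixture`) is the stub's Prop
verbatim, so the skeleton's stub closes by `exact logDerivMixture`.

HONEST FRAMING: an M stub (calculus bookkeeping) of an evidence skeleton (DRAFT-by-design line); the crux `ToronSoftnessSharp` (24196),
the periodic ∀ε law and the leaf `FluxSectorSuppression` are OPEN; no rung / summit statement is proved; the Yang–Mills mass gap is NOT
proved.  THEOREMS ONLY (0 `def`, 0 `sorry`), standard axioms.  References: [cite: MontvayMunster1994, (3.145)]; [cite: tHooft1979].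
-/

set_option autoImplicit false

noncomputable section

open MeasureTheory Filter Set Function
open scoped BigOperators Topology
open Literature.MathematicalPhysics.QuantumFieldTheory hiding SU2

namespace Summit.QuantumFields.YangMills.Theorems.FemtoTransferGap.TT.SectorSmooth

open Summit.QuantumFields.YangMills.Theorems.FemtoTransferGap
open Summit.QuantumFields.YangMills.Theorems.FemtoTransferGap.TT

variable {L : ℕ} [NeZero L]

/-- `Z(L,b,2L) = (1/8) Σ_z W_z(b)` for the `2L`-slice ring (`physTrace L b (2L) = physTraceSucc L b (2L−1)`). [cite: MontvayMunster1994, (3.145)] -/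
theorem physTrace_two_mul_eq_sum_sectorWeight (b : ℝ) :
    physTrace L b (2 * L) = (1 / 8 : ℝ) * ∑ z : Fin 3 → Bool, sectorWeight (L := L) b (2 * L - 1) z (fun _ _ => (1 : ℝ)) :=
  physTraceSucc_eq_sum_sectorWeight b (2 * L - 1)

/-- The ring trace has derivative `(1/8) Σ_z W_z′(β)` in the coupling. [cite: MontvayMunster1994, (3.145)] -/
theorem hasDerivAt_physTrace_two_mul (β : ℝ) :
    HasDerivAt (fun b : ℝ => physTrace L b (2 * L))
      ((1 / 8 : ℝ) * ∑ z : Fin 3 → Bool, deriv (fun b : ℝ => sectorWeight (L := L) b (2 * L - 1) z (fun _ _ => (1 : ℝ))) β) β := by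
  have hfun : (fun b : ℝ => physTrace L b (2 * L)) =
      fun b : ℝ => (1 / 8 : ℝ) * ∑ z : Fin 3 → Bool, sectorWeight (L := L) b (2 * L - 1) z (fun _ _ => (1 : ℝ)) :=
    funext fun b => physTrace_two_mul_eq_sum_sectorWeight b
  rw [hfun]
  refine HasDerivAt.const_mul _ ?_
  exact HasDerivAt.fun_sum (u := (Finset.univ : Finset (Fin 3 → Bool)))
    (A := fun z b => sectorWeight (L := L) b (2 * L - 1) z (fun _ _ => (1 : ℝ)))
    (A' := fun z => deriv (fun b : ℝ => sectorWeight (L := L) b (2 * L - 1) z (fun _ _ => (1 : ℝ))) β) (x := β)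
    (fun z _ => (differentiable_sectorWeight_one (L := L) (2 * L - 1) z β).hasDerivAt)

/-- ★★ **`LogDerivMixture`** (the Prop of stub `stub_logDerivMixture` of LINE «sector-mixture» on crux stmt-QuantumFields-24196, verbatim):
sector probabilities `p_z = W_z(β)/(8Z(β)) ≥ 0`, `Σ_z p_z = 1`, `W_z(β) = p_z·8Z(β)`, and `(log Z)′(β) = Σ_z p_z (log W_z)′(β)`.
No crux / rung / summit is proved; the YM mass gap is NOT proved. [cite: MontvayMunster1994, (3.145)] [cite: tHooft1979] -/
theorem logDerivMixture :
    ∀ (L : ℕ) [NeZero L] (β : ℝ), ∃ p : (Fin 3 → Bool) → ℝ,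
      (∀ z, 0 ≤ p z) ∧ (∑ z, p z = 1) ∧
      (∀ z, TT.sectorWeight (L := L) β (2 * L - 1) z (fun _ _ => (1 : ℝ)) = p z * (8 * TT.physTrace L β (2 * L))) ∧
      deriv (fun b : ℝ => Real.log (TT.physTrace L b (2 * L))) β =
        ∑ z, p z * deriv (fun b : ℝ => Real.log (TT.sectorWeight (L := L) b (2 * L - 1) z (fun _ _ => (1 : ℝ)))) β := by
  intro L _ β
  -- abbreviations
  set W : (Fin 3 → Bool) → ℝ → ℝ := fun z b => sectorWeight (L := L) b (2 * L - 1) z (fun _ _ => (1 : ℝ)) with hW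
  set W' : (Fin 3 → Bool) → ℝ := fun z => deriv (W z) β with hW'
  set Z : ℝ := physTrace L β (2 * L) with hZ
  have hWpos : ∀ z b, 0 < W z b := fun z b => sectorWeight_one_pos (L := L) b (2 * L - 1) z
  have hZsum : Z = (1 / 8 : ℝ) * ∑ z, W z β := physTrace_two_mul_eq_sum_sectorWeight β
  have h8Z : 8 * Z = ∑ z, W z β := by rw [hZsum]; ring
  have hsum_pos : 0 < ∑ z : Fin 3 → Bool, W z β := Finset.sum_pos (fun z _ => hWpos z β) Finset.univ_nonempty
  have hZpos : 0 < Z := by rw [hZsum]; positivity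
  have h8Zpos : 0 < 8 * Z := by positivity
  refine ⟨fun z => W z β / (8 * Z), fun z => div_nonneg (hWpos z β).le h8Zpos.le, ?_, ?_, ?_⟩
  · -- Σ p_z = 1
    rw [← Finset.sum_div, ← h8Z, div_self h8Zpos.ne']
  · -- W_z = p_z · 8Z
    intro z
    show W z β = W z β / (8 * Z) * (8 * Z)
    rw [div_mul_cancel₀ _ h8Zpos.ne']
  · -- the log-derivative identity
    have hZd : HasDerivAt (fun b : ℝ => physTrace L b (2 * L)) ((1 / 8 : ℝ) * ∑ z, W' z) β :=
      hasDerivAt_physTrace_two_mul (L := L) β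
    have hlogZ : HasDerivAt (fun b : ℝ => Real.log (physTrace L b (2 * L))) (((1 / 8 : ℝ) * ∑ z, W' z) / Z) β :=
      hZd.log hZpos.ne'
    have hlogW : ∀ z, HasDerivAt (fun b : ℝ => Real.log (W z b)) (W' z / W z β) β := fun z =>
      ((differentiable_sectorWeight_one (L := L) (2 * L - 1) z β).hasDerivAt).log (hWpos z β).ne'
    rw [hlogZ.deriv]
    have hterm : ∀ z, W z β / (8 * Z) * deriv (fun b : ℝ => Real.log (W z b)) β = W' z / (8 * Z) := by
      intro z
      rw [(hlogW z).deriv]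
      field_simp [(hWpos z β).ne']
    simp_rw [show ∀ z, (fun b : ℝ => Real.log (TT.sectorWeight (L := L) b (2 * L - 1) z (fun _ _ => (1 : ℝ)))) =
      fun b : ℝ => Real.log (W z b) from fun z => rfl]
    rw [Finset.sum_congr rfl fun z _ => hterm z, ← Finset.sum_div]
    field_simp

end Summit.QuantumFields.YangMills.Theorems.FemtoTransferGap.TT.SectorSmooth

end
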